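import Literature.AlgebraicTopology.Homotopy.SerreFibrationCell
import Literature.AlgebraicTopology.Homotopy.CellularSkelPush
import Literature.AlgebraicTopology.SingularHomology.RelativeHomologyExhaustion
import HarnessLib

/-!
# The Serre exact sequence over a CW base: comparison of fibrations in the stable range

Topic `Literature/AlgebraicTopology/Homotopy`. J.-P. Serre, *Homologie singulière des espaces
fibrés*, Ann. of Math. 54 (1951), Ch. III Prop. 5 / Cor. 1 (the exact sequence
`Hᵢ(F) → Hᵢ(E) → Hᵢ(B) → Hᵢ₋₁(F) → ⋯` for `i < p + q` when `B` is `(p-1)`-connected and `F` is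
`(q-1)`-connected, equivalently `p_* : Hᵢ(E, F) ≅ Hᵢ(B, b₀)` for `i < p + q` and onto for
`i = p + q`), in the comparison form produced by the cellular `E¹`-term (E. H. Spanier,
*Algebraic Topology* (1981), Ch. 9, Sec. 2, Lemma 2 and Thm. 15; A. Hatcher, *Algebraic Topology*
(2002), §4.2 and the spectral-sequences chapter, Thm. 5.3 with the "comparison" remark): for a
Hausdorff CW complex `X` with a single `0`-cell `b₀` and no cells of dimension `1, …, m-1`, Serre
fibrations `p : E → X`, `p' : E' → X` and a fibrewise map `f` (`p' ∘ f = p`) which on EVERY fibre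
induces isomorphisms `H_k(p⁻¹x) ≅ H_k(p'⁻¹x)` for `k < r` and a surjection for `k = r`:

* `SerreSkeleta.isIso_map_stage`, `epi_map_stage` — on the pieces over the skeleta,
  `f_* : Hₙ(p⁻¹Xˢ, p⁻¹b₀) → Hₙ(p'⁻¹Xˢ, p'⁻¹b₀)` is an isomorphism for `n < m + r` and onto for
  `n = m + r` (induction on `s`: exact sequences of the triples `(p⁻¹Xˢ, p⁻¹Xˢ⁻¹, p⁻¹b₀)`, the
  four lemmas, the direct-sum decomposition over the `s`-cells `CellsDirectSum.Serre` and the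
  single cell `SerreCell.isIso_map_iff`/`epi_map_iff`);
* `SerreSkeleta.isIso_map`, `epi_map` — **`f_* : Hₙ(E, p⁻¹b₀) → Hₙ(E', p'⁻¹b₀)` is an
  isomorphism for `n < m + r` and onto for `n = m + r`** (the skeleta exhaust and absorb the
  compact subsets, `RelativeHomologyExhaustion.lean`).

The case `E' = X`, `p' = 𝟙`, `f = p` (fibre condition: every fibre path-connected with
`H_k = 0` for `0 < k < r`) is Serre's exact sequence `Hₙ(E, F) ≅ Hₙ(X, b₀)`, `n < m + r`. Also
proved here: the four lemmas (mono / epi) in `ModuleCat` by diagram chase. No named facts.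

## References

* J.-P. Serre, *Homologie singulière des espaces fibrés. Applications*, Ann. of Math. (2) 54
  (1951), 425–505, Ch. III Prop. 5, Cor. 1. [Serre1951]
* E. H. Spanier, *Algebraic Topology*, Springer (1981), Ch. 9, Sec. 2, Lemma 2, Thm. 15; Sec. 3
  Thm. 1 (proof). [Spanier1981]
* A. Hatcher, *Algebraic Topology*, CUP (2002), §2.1 p. 129 (five lemma), Lemma 2.34, §4.2.
  [HatcherAT2002]
-/

noncomputable section

open Set Function Metric unitInterval CategoryTheory CategoryTheory.Limits
open scoped Topology unitInterval Topology.Homotopy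
open Literature.AlgebraicTopology.SingularHomology

namespace Literature.AlgebraicTopology.Homotopy

universe u v uR w

/-! ### The four lemmas in `ModuleCat` -/

namespace SerreSkeleta

section FourLemma

variable {A : Type uR} [Ring A] {P₁ P₂ P₃ P₄ P₅ Q₁ Q₂ Q₃ Q₄ Q₅ : ModuleCat.{w} A}

/-- **The four lemma, injectivity** (Hatcher 2002, §2.1 p. 129, first half of the five lemma):
in a commutative ladder `P₁ → P₂ → P₃ → P₄` over `Q₁ → Q₂ → Q₃ → Q₄` with the top row a complex
at `P₂` and exact at `P₃` and the bottom row exact at `Q₂`, if `a` is onto and `b`, `d` are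
injective then `c` is injective. [cite: HatcherAT2002, §2.1 p. 129 (five lemma)] -/
theorem mono_of_four {f₁ : P₁ ⟶ P₂} {f₂ : P₂ ⟶ P₃} {f₃ : P₃ ⟶ P₄}
    {g₁ : Q₁ ⟶ Q₂} {g₂ : Q₂ ⟶ Q₃} {g₃ : Q₃ ⟶ Q₄}
    (a : P₁ ⟶ Q₁) (b : P₂ ⟶ Q₂) (c : P₃ ⟶ Q₃) (d : P₄ ⟶ Q₄)
    (sq₁ : f₁ ≫ b = a ≫ g₁) (sq₂ : f₂ ≫ c = b ≫ g₂) (sq₃ : f₃ ≫ d = c ≫ g₃)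
    (w₁₂ : f₁ ≫ f₂ = 0) (w₂₃ : f₂ ≫ f₃ = 0) (ex₂₃ : (ShortComplex.mk f₂ f₃ w₂₃).Exact)
    (w₁₂' : g₁ ≫ g₂ = 0) (ex₁₂' : (ShortComplex.mk g₁ g₂ w₁₂').Exact)
    [Epi a] [Mono b] [Mono d] : Mono c := by
  have ha : Surjective a := (ModuleCat.epi_iff_surjective a).mp inferInstance
  have hbi : Injective b := (ModuleCat.mono_iff_injective b).mp inferInstance
  have hdi : Injective d := (ModuleCat.mono_iff_injective d).mp inferInstance
  have sq₁' : ∀ x, b (f₁ x) = g₁ (a x) := fun x => by rw [← ModuleCat.comp_apply, sq₁, ModuleCat.comp_apply]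
  have sq₂' : ∀ x, c (f₂ x) = g₂ (b x) := fun x => by rw [← ModuleCat.comp_apply, sq₂, ModuleCat.comp_apply]
  have sq₃' : ∀ x, d (f₃ x) = g₃ (c x) := fun x => by rw [← ModuleCat.comp_apply, sq₃, ModuleCat.comp_apply]
  have w₁₂p : ∀ x, f₂ (f₁ x) = 0 := fun x => by rw [← ModuleCat.comp_apply, w₁₂]; rfl
  have ex₂₃p := (ShortComplex.moduleCat_exact_iff _).mp ex₂₃
  have ex₁₂p' := (ShortComplex.moduleCat_exact_iff _).mp ex₁₂'
  have hker : ∀ x, c x = 0 → x = 0 := by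
    intro x hx
    have h3 : f₃ x = 0 := hdi (by rw [sq₃', hx, map_zero, map_zero])
    obtain ⟨y, hy⟩ := ex₂₃p x h3
    change f₂ y = x at hy
    have h2 : g₂ (b y) = 0 := by rw [← sq₂', hy, hx]
    obtain ⟨z', hz'⟩ := ex₁₂p' (b y) h2
    change g₁ z' = b y at hz'
    obtain ⟨z, rfl⟩ := ha z'
    have hyz : y = f₁ z := hbi (by rw [sq₁', hz'])
    rw [← hy, hyz, w₁₂p]
  rw [ModuleCat.mono_iff_injective]
  intro x y hxy
  have h : c (x - y) = 0 := by rw [map_sub, hxy, sub_self]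
  exact sub_eq_zero.mp (hker _ h)

/-- **The four lemma, surjectivity** (Hatcher 2002, §2.1 p. 129, second half of the five lemma):
in a commutative ladder `P₂ → P₃ → P₄ → P₅` over `Q₂ → Q₃ → Q₄ → Q₅` with the top row exact at
`P₄` and the bottom row exact at `Q₃` and a complex at `Q₄`, if `b`, `d` are onto and `e` is
injective then `c` is onto. [cite: HatcherAT2002, §2.1 p. 129 (five lemma)] -/
theorem epi_of_four {f₂ : P₂ ⟶ P₃} {f₃ : P₃ ⟶ P₄} {f₄ : P₄ ⟶ P₅}
    {g₂ : Q₂ ⟶ Q₃} {g₃ : Q₃ ⟶ Q₄} {g₄ : Q₄ ⟶ Q₅}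
    (b : P₂ ⟶ Q₂) (c : P₃ ⟶ Q₃) (d : P₄ ⟶ Q₄) (e : P₅ ⟶ Q₅)
    (sq₂ : f₂ ≫ c = b ≫ g₂) (sq₃ : f₃ ≫ d = c ≫ g₃) (sq₄ : f₄ ≫ e = d ≫ g₄)
    (w₃₄ : f₃ ≫ f₄ = 0) (ex₃₄ : (ShortComplex.mk f₃ f₄ w₃₄).Exact)
    (w₂₃' : g₂ ≫ g₃ = 0) (ex₂₃' : (ShortComplex.mk g₂ g₃ w₂₃').Exact) (w₃₄' : g₃ ≫ g₄ = 0)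
    [Epi b] [Epi d] [Mono e] : Epi c := by
  have hbs : Surjective b := (ModuleCat.epi_iff_surjective b).mp inferInstance
  have hds : Surjective d := (ModuleCat.epi_iff_surjective d).mp inferInstance
  have he : Injective e := (ModuleCat.mono_iff_injective e).mp inferInstance
  have sq₂' : ∀ x, c (f₂ x) = g₂ (b x) := fun x => by rw [← ModuleCat.comp_apply, sq₂, ModuleCat.comp_apply]
  have sq₃' : ∀ x, d (f₃ x) = g₃ (c x) := fun x => by rw [← ModuleCat.comp_apply, sq₃, ModuleCat.comp_apply]
  have sq₄' : ∀ x, e (f₄ x) = g₄ (d x) := fun x => by rw [← ModuleCat.comp_apply, sq₄, ModuleCat.comp_apply]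
  have w₃₄p' : ∀ x, g₄ (g₃ x) = 0 := fun x => by rw [← ModuleCat.comp_apply, w₃₄']; rfl
  have ex₃₄p := (ShortComplex.moduleCat_exact_iff _).mp ex₃₄
  have ex₂₃p' := (ShortComplex.moduleCat_exact_iff _).mp ex₂₃'
  rw [ModuleCat.epi_iff_surjective]
  intro x'
  obtain ⟨w, hw⟩ := hds (g₃ x')
  have h4 : f₄ w = 0 := he (by rw [sq₄', hw, w₃₄p', map_zero])
  obtain ⟨x, hx⟩ := ex₃₄p w h4
  change f₃ x = w at hx
  have h3 : g₃ (x' - c x) = 0 := by rw [map_sub, ← sq₃', hx, hw, sub_self]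
  obtain ⟨y', hy'⟩ := ex₂₃p' _ h3
  change g₂ y' = x' - c x at hy'
  obtain ⟨y, rfl⟩ := hbs y'
  exact ⟨x + f₂ y, by rw [map_add, sq₂', hy', add_sub_cancel]⟩

/-- **The four lemma, surjectivity, truncated form**: as `epi_of_four` but with the top map
`f₃` onto in place of the exactness at `P₄` and the injectivity of `e` (the situation at the end
`⋯ → H₀(X, B) → H₀(X, A) → 0` of the exact sequence of a triple). [cite: HatcherAT2002, §2.1 p. 129 (five lemma)] -/
theorem epi_of_three {f₂ : P₂ ⟶ P₃} {f₃ : P₃ ⟶ P₄} {g₂ : Q₂ ⟶ Q₃} {g₃ : Q₃ ⟶ Q₄}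
    (b : P₂ ⟶ Q₂) (c : P₃ ⟶ Q₃) (d : P₄ ⟶ Q₄)
    (sq₂ : f₂ ≫ c = b ≫ g₂) (sq₃ : f₃ ≫ d = c ≫ g₃)
    (w₂₃' : g₂ ≫ g₃ = 0) (ex₂₃' : (ShortComplex.mk g₂ g₃ w₂₃').Exact)
    [Epi b] [Epi d] [Epi f₃] : Epi c := by
  have hbs : Surjective b := (ModuleCat.epi_iff_surjective b).mp inferInstance
  have hds : Surjective d := (ModuleCat.epi_iff_surjective d).mp inferInstance
  have hfs : Surjective f₃ := (ModuleCat.epi_iff_surjective f₃).mp inferInstance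
  have sq₂' : ∀ x, c (f₂ x) = g₂ (b x) := fun x => by rw [← ModuleCat.comp_apply, sq₂, ModuleCat.comp_apply]
  have sq₃' : ∀ x, d (f₃ x) = g₃ (c x) := fun x => by rw [← ModuleCat.comp_apply, sq₃, ModuleCat.comp_apply]
  have ex₂₃p' := (ShortComplex.moduleCat_exact_iff _).mp ex₂₃'
  rw [ModuleCat.epi_iff_surjective]
  intro x'
  obtain ⟨w, hw⟩ := hds (g₃ x')
  obtain ⟨x, hx⟩ := hfs w
  have h3 : g₃ (x' - c x) = 0 := by rw [map_sub, ← sq₃', hx, hw, sub_self]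
  obtain ⟨y', hy'⟩ := ex₂₃p' _ h3
  change g₂ y' = x' - c x at hy'
  obtain ⟨y, rfl⟩ := hbs y'
  exact ⟨x + f₂ y, by rw [map_add, sq₂', hy', add_sub_cancel]⟩

end FourLemma

/-! ### The pieces over the skeleta and the stage maps -/

section Stage

open _root_.Topology RelCWComplex SkeletonCollar CellsDirectSum

variable (R : Type uR) [CommRing R]
variable {X : Type v} [TopologicalSpace X] [T2Space X] [CWComplex (univ : Set X)]
variable {E E' : Type u} [TopologicalSpace E] [TopologicalSpace E'] {p : E → X} {p' : E' → X}

variable (X) in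
/-- The `s`-skeleton `Xˢ` (Mathlib's `skeletonLT (s + 1)`), so that `tot p s = p⁻¹(skel X s)`. [folklore] -/
abbrev skel (s : ℕ) : Set X := (skeletonLT (univ : Set X) ((s : ℕ∞) + 1) : Set X)

/-- The skeleta increase. [folklore] -/
theorem skel_mono {s t : ℕ} (h : s ≤ t) : skel X s ⊆ skel X t :=
  skeletonLT_mono (by exact_mod_cast Nat.succ_le_succ h)

omit [TopologicalSpace E] in
/-- `Xˢ ⊆ Xˢ⁺¹` in the form `skeletonLT (s + 1) ⊆ skeletonLT ((s + 1) + 1)` used by `low`/`tot`. [folklore] -/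
theorem mem_low_succ_iff (s : ℕ) (z : ↥(tot p (s + 1))) : z ∈ low p (s + 1) ↔ (z : E) ∈ tot p s := by
  show p z.1 ∈ (skeletonLT (univ : Set X) ((s + 1 : ℕ) : ℕ∞) : Set X) ↔ p z.1 ∈ (skeletonLT (univ : Set X) ((s : ℕ∞) + 1) : Set X)
  rw [Nat.cast_succ]

/-- `p⁻¹Xˢ⁻¹ ≅ₜ p⁻¹Xˢ⁻¹` — the subset `low p (s+1)` of `p⁻¹Xˢ⁺¹… ` is the previous stage `tot p s`. [folklore] -/
def lowHomeomorph (p : E → X) (s : ℕ) : ↥(low p (s + 1)) ≃ₜ ↥(tot p s) where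
  toFun z := ⟨z.1.1, (mem_low_succ_iff s z.1).1 z.2⟩
  invFun w := ⟨⟨w.1, skel_mono (Nat.le_succ s) w.2⟩, (mem_low_succ_iff s _).2 w.2⟩
  left_inv _ := rfl
  right_inv _ := rfl
  continuous_toFun := (continuous_subtype_val.comp continuous_subtype_val).subtype_mk _
  continuous_invFun := (continuous_subtype_val.subtype_mk _).subtype_mk _

/-- The fibrewise map respects the pieces over the skeleta. [folklore] -/
theorem mapsTo_tot (f : C(E, E')) (hf : ∀ e, p' (f e) = p e) (s : ℕ) : MapsTo f (tot p s) (tot p' s) := SerreCell.mapsTo_preimage f hf (skel X s)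

/-- **The stage map** `p⁻¹Xˢ → p'⁻¹Xˢ`. [folklore] -/
def stageMap (f : C(E, E')) (hf : ∀ e, p' (f e) = p e) (s : ℕ) : C(↥(tot p s), ↥(tot p' s)) := subsetRestrict f (mapsTo_tot f hf s)

/-- The stage map respects the fibres over `b₀`. [folklore] -/
theorem mapsTo_stageMap_fib (f : C(E, E')) (hf : ∀ e, p' (f e) = p e) (b₀ : X) (s : ℕ) :
    MapsTo (stageMap f hf s) (Subtype.val ⁻¹' (p ⁻¹' {b₀})) (Subtype.val ⁻¹' (p' ⁻¹' {b₀})) :=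
  mapsTo_subsetRestrict_preimage f (mapsTo_tot f hf s) (SerreCell.mapsTo_preimage f hf {b₀})

/-- The stage map respects the previous stage. [folklore] -/
theorem mapsTo_stageMap_low (f : C(E, E')) (hf : ∀ e, p' (f e) = p e) (s : ℕ) : MapsTo (stageMap f hf s) (low p s) (low p' s) :=
  fun z hz => by
    show p' (f z.1) ∈ (skeletonLT (univ : Set X) (s : ℕ∞) : Set X)
    rw [hf]; exact hz

/-- The stage map on the previous stage respects the fibres over `b₀`. [folklore] -/
theorem mapsTo_restrict_low_fib (f : C(E, E')) (hf : ∀ e, p' (f e) = p e) (b₀ : X) (s : ℕ) :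
    MapsTo (subsetRestrict (stageMap f hf s) (mapsTo_stageMap_low f hf s))
      (Subtype.val ⁻¹' (Subtype.val ⁻¹' (p ⁻¹' {b₀}))) (Subtype.val ⁻¹' (Subtype.val ⁻¹' (p' ⁻¹' {b₀}))) :=
  fun z hz => by
    show p' (f z.1.1) ∈ ({b₀} : Set X)
    rw [hf]; exact hz

/-- `f_* : Hₙ(p⁻¹Xˢ, p⁻¹b₀) → Hₙ(p'⁻¹Xˢ, p'⁻¹b₀)`, the map to be studied. [folklore] -/
abbrev cmap (f : C(E, E')) (hf : ∀ e, p' (f e) = p e) (b₀ : X) (n s : ℕ) :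
    relativeSingularHomology R R ↥(tot p s) (Subtype.val ⁻¹' (p ⁻¹' {b₀})) n ⟶
      relativeSingularHomology R R ↥(tot p' s) (Subtype.val ⁻¹' (p' ⁻¹' {b₀})) n :=
  relativeSingularHomology.map R R (stageMap f hf s) (mapsTo_stageMap_fib f hf b₀ s) n

/-- `f_* : Hₙ(p⁻¹Xˢ, p⁻¹Xˢ⁻¹) → Hₙ(p'⁻¹Xˢ, p'⁻¹Xˢ⁻¹)`, the map on the `E¹`-terms. [folklore] -/
abbrev dmap (f : C(E, E')) (hf : ∀ e, p' (f e) = p e) (n s : ℕ) :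
    relativeSingularHomology R R ↥(tot p s) (low p s) n ⟶ relativeSingularHomology R R ↥(tot p' s) (low p' s) n :=
  relativeSingularHomology.map R R (stageMap f hf s) (mapsTo_stageMap_low f hf s) n

/-- The map on one cell: `f_* : Hₙ(p⁻¹ēⱼ, p⁻¹ėⱼ) → Hₙ(p'⁻¹ēⱼ, p'⁻¹ėⱼ)`. [folklore] -/
abbrev cellMap (f : C(E, E')) (hf : ∀ e, p' (f e) = p e) (n : ℕ) {s : ℕ} (j : cell (univ : Set X) s) :
    relativeSingularHomology R R (Cl p j) (fr p j) n ⟶ relativeSingularHomology R R (Cl p' j) (fr p' j) n :=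
  relativeSingularHomology.map R R (SerreCell.restrictPreimage f hf (closedCell s j)) (SerreCell.mapsTo_restrictPreimage_fr j f hf) n

/-! ### The `E¹`-terms: direct sums over the cells -/

/-- The stage map commutes with the inclusions of the pieces over the closed cells. [folklore] -/
theorem stageMap_comp_ιCY (f : C(E, E')) (hf : ∀ e, p' (f e) = p e) {s : ℕ} (j : cell (univ : Set X) s) :
    (stageMap f hf s).comp (ιCY p j) = (ιCY p' j).comp (SerreCell.restrictPreimage f hf (closedCell s j)) :=
  ContinuousMap.ext fun _ => rfl

/-- **`f_*` on `Hₙ(p⁻¹Xˢ, p⁻¹Xˢ⁻¹)` is injective (resp. onto) as soon as it is on every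
`Hₙ(p⁻¹ēⱼ, p⁻¹ėⱼ)`** (the direct-sum decomposition `CellsDirectSum.Serre`, natural in `f`).
[cite: Spanier1981, Ch. 9, Sec. 2, Lemma 2] -/
theorem mono_epi_dmap (f : C(E, E')) (hf : ∀ e, p' (f e) = p e) (hp : IsSerreFibration p) (hp' : IsSerreFibration p') (n s : ℕ) :
    ((∀ j : cell (univ : Set X) s, Mono (cellMap R f hf n j)) → Mono (dmap R f hf n s)) ∧
    ((∀ j : cell (univ : Set X) s, Epi (cellMap R f hf n j)) → Epi (dmap R f hf n s)) := by
  classical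
  have hΦ := Serre.directSum_map_ιCY_bijective R hp (s := s) n
  have hΦ' := Serre.directSum_map_ιCY_bijective R hp' (s := s) n
  set Φ := DirectSum.toModule R (cell (univ : Set X) s) (relativeSingularHomology R R ↥(tot p s) (low p s) n)
    fun j => (relativeSingularHomology.map R R (ιCY p j) (mapsTo_ιCY_fr j) n).hom with hΦdef
  set Φ' := DirectSum.toModule R (cell (univ : Set X) s) (relativeSingularHomology R R ↥(tot p' s) (low p' s) n)
    fun j => (relativeSingularHomology.map R R (ιCY p' j) (mapsTo_ιCY_fr j) n).hom with hΦ'def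
  set L : (DirectSum (cell (univ : Set X) s) fun j => relativeSingularHomology R R (Cl p j) (fr p j) n) →ₗ[R]
      DirectSum (cell (univ : Set X) s) fun j => relativeSingularHomology R R (Cl p' j) (fr p' j) n :=
    DirectSum.lmap fun j => (cellMap R f hf n j).hom with hL
  have hsq : (dmap R f hf n s).hom ∘ₗ Φ = Φ' ∘ₗ L := by
    refine DirectSum.linearMap_ext R fun j => LinearMap.ext fun x => ?_
    simp only [LinearMap.comp_apply, hΦdef, hΦ'def, hL, DirectSum.toModule_lof, DirectSum.lmap_lof]
    change (relativeSingularHomology.map R R (ιCY p j) (mapsTo_ιCY_fr j) n ≫ dmap R f hf n s) x =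
      (cellMap R f hf n j ≫ relativeSingularHomology.map R R (ιCY p' j) (mapsTo_ιCY_fr j) n) x
    have hm : relativeSingularHomology.map R R (ιCY p j) (mapsTo_ιCY_fr j) n ≫ dmap R f hf n s =
        cellMap R f hf n j ≫ relativeSingularHomology.map R R (ιCY p' j) (mapsTo_ιCY_fr j) n := by
      rw [dmap, cellMap, ← relativeSingularHomology.map_comp, ← relativeSingularHomology.map_comp]
      exact relativeSingularHomology.map_congr R R (stageMap_comp_ιCY f hf j) _ _ n
    exact congrArg (fun g => (ModuleCat.Hom.hom g) x) hm
  have hsq' : ∀ y, (dmap R f hf n s) (Φ y) = Φ' (L y) := fun y => congrArg (fun g => g y) (congrArg DFunLike.coe hsq)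
  constructor
  · intro hmono
    have hL_inj : Injective L := (DirectSum.lmap_injective _).2 fun j =>
      (ModuleCat.mono_iff_injective _).1 (hmono j)
    refine (ModuleCat.mono_iff_injective _).2 ((injective_iff_map_eq_zero _).2 fun x hx => ?_)
    obtain ⟨y, rfl⟩ := hΦ.2 x
    have h1 : Φ' (L y) = 0 := by rw [← hsq', hx]
    have h2 : L y = 0 := hΦ'.1 (by rw [h1, map_zero])
    rw [hL_inj (by rw [h2, map_zero] : L y = L 0), map_zero]
  · intro hepi
    have hL_surj : Surjective L := (DirectSum.lmap_surjective _).2 fun j =>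
      (ModuleCat.epi_iff_surjective _).1 (hepi j)
    refine (ModuleCat.epi_iff_surjective _).2 fun x' => ?_
    obtain ⟨y', rfl⟩ := hΦ'.2 x'
    obtain ⟨y, rfl⟩ := hL_surj y'
    exact ⟨Φ y, hsq' y⟩

/-! ### One cell, from the fibre condition -/

variable (f : C(E, E')) (hf : ∀ e, p' (f e) = p e) {m r : ℕ} (hcells : ∀ k, 1 ≤ k → k < m → IsEmpty (cell (univ : Set X) k))
  (hfib : ∀ x : X, (∀ k, k < r → IsIso (singularHomology.map R R (SerreCell.restrictPreimage f hf {x}) k)) ∧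
    Epi (singularHomology.map R R (SerreCell.restrictPreimage f hf {x}) r))

include hcells hfib in
/-- **The map on one cell in the stable range**: for a cell of dimension `s + 1`,
`f_* : Hₙ(p⁻¹ēⱼ, p⁻¹ėⱼ) → Hₙ(p'⁻¹ēⱼ, p'⁻¹ėⱼ)` is an isomorphism for `n < m + r` and onto for
`n ≤ m + r` (`SerreCell.isIso_map_iff`, `epi_map_iff` and the fibre condition; cells of
dimension `1 ≤ s + 1 < m` do not exist). [cite: Spanier1981, Ch. 9, Sec. 2, Thm. 15 (a)] -/
theorem cellMap_stable (hp : IsSerreFibration p) (hp' : IsSerreFibration p') (n s : ℕ) (j : cell (univ : Set X) (s + 1)) :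
    (n < m + r → IsIso (cellMap R f hf n j)) ∧ (n ≤ m + r → Epi (cellMap R f hf n j)) := by
  -- cells of dimension `s + 1 < m` do not exist
  by_cases hsm : s + 1 < m
  · exact (hcells (s + 1) (Nat.succ_pos s) hsm).elim j
  have hms : m ≤ s + 1 := not_lt.1 hsm
  -- below the cell dimension both sides vanish
  by_cases hns : n < s + 1
  · have h1 := SerreCell.isZero_of_lt R j hp hns
    have h2 := SerreCell.isZero_of_lt R j hp' hns
    haveI : IsIso (cellMap R f hf n j) := isIso_of_source_target_iso_zero _ h1.isoZero h2.isoZero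
    exact ⟨fun _ => inferInstance, fun _ => inferInstance⟩
  obtain ⟨k, rfl⟩ : ∃ k, n = k + (s + 1) := ⟨n - (s + 1), by omega⟩
  constructor
  · intro hn
    have hk : k < r := by omega
    exact (SerreCell.isIso_map_iff R j f hf hp hp' k).2 ((hfib _).1 k hk)
  · intro hn
    rcases (show k < r ∨ k = r by omega) with hk | rfl
    · haveI := (SerreCell.isIso_map_iff R j f hf hp hp' k).2 ((hfib _).1 k hk)
      infer_instance
    · exact (SerreCell.epi_map_iff R j f hf hp hp' k).2 (hfib _).2

/-! ### The induction over the skeleta -/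

variable (b₀ : X) (h0 : ∀ x : X, x ∈ skel X 0 ↔ x = b₀)

include h0 in
/-- `b₀` lies in every skeleton. [folklore] -/
theorem b0_mem_skel (s : ℕ) : b₀ ∈ skel X s := skel_mono (Nat.zero_le s) ((h0 b₀).2 rfl)

include h0 in
omit [TopologicalSpace E] in
/-- `p⁻¹b₀ ⊆ p⁻¹Xˢ⁻¹` inside `p⁻¹Xˢ` (the triple `(p⁻¹Xˢ, p⁻¹Xˢ⁻¹, p⁻¹b₀)`), `s ≥ 1`. [folklore] -/
theorem fib_subset_low (s : ℕ) : (Subtype.val ⁻¹' (p ⁻¹' {b₀}) : Set ↥(tot p (s + 1))) ⊆ low p (s + 1) := by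
  intro z hz
  have hz' : p z.1 = b₀ := hz
  show p z.1 ∈ (skeletonLT (univ : Set X) ((s + 1 : ℕ) : ℕ∞) : Set X)
  rw [hz', Nat.cast_succ]
  exact b0_mem_skel b₀ h0 s

include h0 in
/-- **Stage `0`**: `Hₙ(p⁻¹X⁰, p⁻¹b₀) = 0` (`X⁰ = {b₀}`). [folklore] -/
theorem isZero_stage_zero (n : ℕ) :
    IsZero (relativeSingularHomology R R ↥(tot p 0) (Subtype.val ⁻¹' (p ⁻¹' {b₀})) n) := by
  have huniv : ∀ z : ↥(tot p 0), z ∈ (Subtype.val ⁻¹' (p ⁻¹' {b₀}) : Set ↥(tot p 0)) := fun z => (h0 _).1 z.2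
  refine (isZero_relativeSingularHomology_univ R R n).of_iso
    (relativeSingularHomology.mapHomeomorph R R (Homeomorph.refl ↥(tot p 0)) (fun z _ => mem_univ _)
      (fun z _ => huniv z) n)

include hcells hfib h0 in
/-- **The induction over the skeleta** (Spanier 1981, proof of Thm. 9.3.1; Serre 1951, III §4):
`f_* : Hₙ(p⁻¹Xˢ, p⁻¹b₀) → Hₙ(p'⁻¹Xˢ, p'⁻¹b₀)` is an isomorphism for `n < m + r` and onto for
`n ≤ m + r`. [cite: Spanier1981, Ch. 9, Sec. 2, Thm. 15 and Sec. 3, Thm. 1 (proof)] -/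
theorem stage (hp : IsSerreFibration p) (hp' : IsSerreFibration p') :
    ∀ (s n : ℕ), (n < m + r → IsIso (cmap R f hf b₀ n s)) ∧ (n ≤ m + r → Epi (cmap R f hf b₀ n s)) := by
  intro s
  induction s with
  | zero =>
    intro n
    haveI : IsIso (cmap R f hf b₀ n 0) := isIso_of_source_target_iso_zero _
      (isZero_stage_zero R b₀ h0 n).isoZero (isZero_stage_zero R b₀ h0 n).isoZero
    exact ⟨fun _ => inferInstance, fun _ => inferInstance⟩
  | succ s ih =>
    intro n
    -- notation for the triple `(X₁, A₁, B₁) = (p⁻¹Xˢ⁺¹, p⁻¹Xˢ, p⁻¹b₀)` and its primed version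
    have hBA := fib_subset_low (p := p) b₀ h0 s
    have hBA' := fib_subset_low (p := p') b₀ h0 s
    -- (b) the map on `Hₖ(A₁, B₁)` is the stage-`s` map up to the homeomorphisms `lowHomeomorph`
    have hb : ∀ k, (k < m + r → IsIso (relativeSingularHomology.map R R
        (subsetRestrict (stageMap f hf (s + 1)) (mapsTo_stageMap_low f hf (s + 1))) (mapsTo_restrict_low_fib f hf b₀ (s + 1)) k)) ∧
        (k ≤ m + r → Epi (relativeSingularHomology.map R R
        (subsetRestrict (stageMap f hf (s + 1)) (mapsTo_stageMap_low f hf (s + 1))) (mapsTo_restrict_low_fib f hf b₀ (s + 1)) k)) := by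
      intro k
      have he : MapsTo (lowHomeomorph p s) (Subtype.val ⁻¹' (Subtype.val ⁻¹' (p ⁻¹' {b₀}))) (Subtype.val ⁻¹' (p ⁻¹' {b₀})) :=
        fun z hz => hz
      have he_symm : MapsTo (lowHomeomorph p s).symm (Subtype.val ⁻¹' (p ⁻¹' {b₀})) (Subtype.val ⁻¹' (Subtype.val ⁻¹' (p ⁻¹' {b₀}))) :=
        fun z hz => hz
      have he' : MapsTo (lowHomeomorph p' s) (Subtype.val ⁻¹' (Subtype.val ⁻¹' (p' ⁻¹' {b₀}))) (Subtype.val ⁻¹' (p' ⁻¹' {b₀})) :=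
        fun z hz => hz
      have he'_symm : MapsTo (lowHomeomorph p' s).symm (Subtype.val ⁻¹' (p' ⁻¹' {b₀})) (Subtype.val ⁻¹' (Subtype.val ⁻¹' (p' ⁻¹' {b₀}))) :=
        fun z hz => hz
      haveI := relativeSingularHomology.isIso_map_homeomorph R R (lowHomeomorph p s) he he_symm k
      haveI := relativeSingularHomology.isIso_map_homeomorph R R (lowHomeomorph p' s) he' he'_symm k
      have hsq : relativeSingularHomology.map R R
          (subsetRestrict (stageMap f hf (s + 1)) (mapsTo_stageMap_low f hf (s + 1))) (mapsTo_restrict_low_fib f hf b₀ (s + 1)) k ≫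
          relativeSingularHomology.map R R (lowHomeomorph p' s : C(↥(low p' (s + 1)), ↥(tot p' s))) he' k =
          relativeSingularHomology.map R R (lowHomeomorph p s : C(↥(low p (s + 1)), ↥(tot p s))) he k ≫ cmap R f hf b₀ k s := by
        rw [cmap, ← relativeSingularHomology.map_comp, ← relativeSingularHomology.map_comp]
        exact relativeSingularHomology.map_congr R R (ContinuousMap.ext fun _ => rfl) _ _ k
      exact ⟨fun hk => (SerreCube.isIso_iff_of_square _ _ hsq).2 ((ih k).1 hk),
        fun hk => (SerreCube.epi_iff_of_square _ _ hsq).2 ((ih k).2 hk)⟩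
    -- (d) the map on `Hₖ(X₁, A₁)`
    have hd : ∀ k, (k < m + r → Mono (dmap R f hf k (s + 1))) ∧ (k ≤ m + r → Epi (dmap R f hf k (s + 1))) := by
      intro k
      refine ⟨fun hk => (mono_epi_dmap R f hf hp hp' k (s + 1)).1 fun j => ?_,
        fun hk => (mono_epi_dmap R f hf hp hp' k (s + 1)).2 fun j => ((cellMap_stable R f hf hcells hfib hp hp' k s j).2 hk)⟩
      haveI := (cellMap_stable R f hf hcells hfib hp hp' k s j).1 hk
      infer_instance
    -- the squares of the ladder
    have sq_i : ∀ k, relativeSingularHomology.map R R (⟨Subtype.val, continuous_subtype_val⟩ : C(↥(low p (s + 1)), ↥(tot p (s + 1))))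
        (mapsTo_val_preimage (low p (s + 1)) (Subtype.val ⁻¹' (p ⁻¹' {b₀}))) k ≫ cmap R f hf b₀ k (s + 1) =
        relativeSingularHomology.map R R
          (subsetRestrict (stageMap f hf (s + 1)) (mapsTo_stageMap_low f hf (s + 1))) (mapsTo_restrict_low_fib f hf b₀ (s + 1)) k ≫
        relativeSingularHomology.map R R (⟨Subtype.val, continuous_subtype_val⟩ : C(↥(low p' (s + 1)), ↥(tot p' (s + 1))))
          (mapsTo_val_preimage (low p' (s + 1)) (Subtype.val ⁻¹' (p' ⁻¹' {b₀}))) k := by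
      intro k
      rw [cmap, ← relativeSingularHomology.map_comp, ← relativeSingularHomology.map_comp]; rfl
    have sq_j : ∀ k, relativeSingularHomology.map R R (ContinuousMap.id ↥(tot p (s + 1))) (mapsTo_id_of_subset hBA) k ≫ dmap R f hf k (s + 1) =
        cmap R f hf b₀ k (s + 1) ≫ relativeSingularHomology.map R R (ContinuousMap.id ↥(tot p' (s + 1))) (mapsTo_id_of_subset hBA') k := by
      intro k
      rw [cmap, dmap, ← relativeSingularHomology.map_comp, ← relativeSingularHomology.map_comp]; rfl
    have sq_δ : ∀ k, dmap R f hf (k + 1) (s + 1) ≫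
          relativeSingularHomology.tripleδ R R ↥(tot p' (s + 1)) (low p' (s + 1)) (Subtype.val ⁻¹' (p' ⁻¹' {b₀})) k =
        relativeSingularHomology.tripleδ R R ↥(tot p (s + 1)) (low p (s + 1)) (Subtype.val ⁻¹' (p ⁻¹' {b₀})) k ≫
          relativeSingularHomology.map R R
            (subsetRestrict (stageMap f hf (s + 1)) (mapsTo_stageMap_low f hf (s + 1))) (mapsTo_restrict_low_fib f hf b₀ (s + 1)) k := by
      intro k
      rw [dmap, relativeSingularHomology.tripleδ, relativeSingularHomology.tripleδ, Category.assoc,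
        relativeSingularHomology.ofAbsolute_comp_map, ← Category.assoc,
        ← relativeSingularHomology.δ_naturality, Category.assoc]
    -- exactness of the two rows
    have ex₁ := fun k => relativeSingularHomology.triple_exact₁ R R hBA k
    have ex₂ := fun k => relativeSingularHomology.triple_exact₂ R R hBA k
    have ex₃ := fun k => relativeSingularHomology.triple_exact₃ R R hBA k
    have ex₁' := fun k => relativeSingularHomology.triple_exact₁ R R hBA' k
    have ex₂' := fun k => relativeSingularHomology.triple_exact₂ R R hBA' k
    have ex₃' := fun k => relativeSingularHomology.triple_exact₃ R R hBA' k
    refine ⟨fun hn => ?_, fun hn => ?_⟩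
    · -- isomorphism for `n < m + r`: mono by `mono_of_four`, epi by `epi_of_four` / `epi_of_three`
      haveI : Epi (dmap R f hf (n + 1) (s + 1)) := (hd (n + 1)).2 (by omega)
      haveI : Mono (relativeSingularHomology.map R R
        (subsetRestrict (stageMap f hf (s + 1)) (mapsTo_stageMap_low f hf (s + 1))) (mapsTo_restrict_low_fib f hf b₀ (s + 1)) n) := by
        haveI := (hb n).1 hn; infer_instance
      haveI : Mono (dmap R f hf n (s + 1)) := (hd n).1 hn
      haveI hmono : Mono (cmap R f hf b₀ n (s + 1)) :=
        mono_of_four (dmap R f hf (n + 1) (s + 1)) _ (cmap R f hf b₀ n (s + 1)) (dmap R f hf n (s + 1))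
          (sq_δ n).symm (sq_i n) (sq_j n)
          (relativeSingularHomology.tripleδ_comp_map R R hBA n) (relativeSingularHomology.map_val_comp_map_id R R hBA n) (ex₂ n)
          (relativeSingularHomology.tripleδ_comp_map R R hBA' n) (ex₁' n)
      haveI hepi : Epi (cmap R f hf b₀ n (s + 1)) := by
        haveI : Epi (relativeSingularHomology.map R R
          (subsetRestrict (stageMap f hf (s + 1)) (mapsTo_stageMap_low f hf (s + 1))) (mapsTo_restrict_low_fib f hf b₀ (s + 1)) n) :=
          (hb n).2 hn.le
        haveI : Epi (dmap R f hf n (s + 1)) := (hd n).2 hn.le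
        cases n with
        | zero =>
          haveI : Epi (relativeSingularHomology.map R R (ContinuousMap.id ↥(tot p (s + 1))) (mapsTo_id_of_subset hBA) 0) := by
            haveI := relativeSingularHomology.epi_ofAbsolute_zero R R (X := ↥(tot p (s + 1))) (low p (s + 1))
            have hfac : relativeSingularHomology.ofAbsolute R R ↥(tot p (s + 1)) (Subtype.val ⁻¹' (p ⁻¹' {b₀})) 0 ≫
                relativeSingularHomology.map R R (ContinuousMap.id ↥(tot p (s + 1))) (mapsTo_id_of_subset hBA) 0 =
                relativeSingularHomology.ofAbsolute R R ↥(tot p (s + 1)) (low p (s + 1)) 0 := by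
              rw [relativeSingularHomology.ofAbsolute_comp_map, singularHomology.map_id, Category.id_comp]
            exact epi_of_epi_fac hfac
          exact epi_of_three _ (cmap R f hf b₀ 0 (s + 1)) (dmap R f hf 0 (s + 1)) (sq_i 0) (sq_j 0)
            (relativeSingularHomology.map_val_comp_map_id R R hBA' 0) (ex₂' 0)
        | succ n =>
          haveI : Mono (relativeSingularHomology.map R R
            (subsetRestrict (stageMap f hf (s + 1)) (mapsTo_stageMap_low f hf (s + 1))) (mapsTo_restrict_low_fib f hf b₀ (s + 1)) n) := by
            haveI := (hb n).1 (by omega); infer_instance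
          exact epi_of_four _ (cmap R f hf b₀ (n + 1) (s + 1)) (dmap R f hf (n + 1) (s + 1)) _
            (sq_i (n + 1)) (sq_j (n + 1)) (sq_δ n).symm
            (relativeSingularHomology.map_comp_tripleδ R R hBA n) (ex₃ n)
            (relativeSingularHomology.map_val_comp_map_id R R hBA' (n + 1)) (ex₂' (n + 1))
            (relativeSingularHomology.map_comp_tripleδ R R hBA' n)
      exact isIso_of_mono_of_epi _
    · -- surjectivity for `n ≤ m + r`
      haveI : Epi (relativeSingularHomology.map R R
        (subsetRestrict (stageMap f hf (s + 1)) (mapsTo_stageMap_low f hf (s + 1))) (mapsTo_restrict_low_fib f hf b₀ (s + 1)) n) :=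
        (hb n).2 hn
      haveI : Epi (dmap R f hf n (s + 1)) := (hd n).2 hn
      cases n with
      | zero =>
        haveI : Epi (relativeSingularHomology.map R R (ContinuousMap.id ↥(tot p (s + 1))) (mapsTo_id_of_subset hBA) 0) := by
          haveI := relativeSingularHomology.epi_ofAbsolute_zero R R (X := ↥(tot p (s + 1))) (low p (s + 1))
          have hfac : relativeSingularHomology.ofAbsolute R R ↥(tot p (s + 1)) (Subtype.val ⁻¹' (p ⁻¹' {b₀})) 0 ≫
              relativeSingularHomology.map R R (ContinuousMap.id ↥(tot p (s + 1))) (mapsTo_id_of_subset hBA) 0 =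
              relativeSingularHomology.ofAbsolute R R ↥(tot p (s + 1)) (low p (s + 1)) 0 := by
            rw [relativeSingularHomology.ofAbsolute_comp_map, singularHomology.map_id, Category.id_comp]
          exact epi_of_epi_fac hfac
        exact epi_of_three _ (cmap R f hf b₀ 0 (s + 1)) (dmap R f hf 0 (s + 1)) (sq_i 0) (sq_j 0)
          (relativeSingularHomology.map_val_comp_map_id R R hBA' 0) (ex₂' 0)
      | succ n =>
        haveI : Mono (relativeSingularHomology.map R R
          (subsetRestrict (stageMap f hf (s + 1)) (mapsTo_stageMap_low f hf (s + 1))) (mapsTo_restrict_low_fib f hf b₀ (s + 1)) n) := by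
          haveI := (hb n).1 (by omega); infer_instance
        exact epi_of_four _ (cmap R f hf b₀ (n + 1) (s + 1)) (dmap R f hf (n + 1) (s + 1)) _
          (sq_i (n + 1)) (sq_j (n + 1)) (sq_δ n).symm
          (relativeSingularHomology.map_comp_tripleδ R R hBA n) (ex₃ n)
          (relativeSingularHomology.map_val_comp_map_id R R hBA' (n + 1)) (ex₂' (n + 1))
          (relativeSingularHomology.map_comp_tripleδ R R hBA' n)

include hcells hfib h0 in
/-- **Stages, isomorphism range.** [cite: Spanier1981, Ch. 9, Sec. 2, Thm. 15; Sec. 3, Thm. 1 (proof)] -/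
theorem isIso_map_stage (hp : IsSerreFibration p) (hp' : IsSerreFibration p') (s : ℕ) {n : ℕ} (hn : n < m + r) :
    IsIso (cmap R f hf b₀ n s) :=
  ((stage R f hf hcells hfib b₀ h0 hp hp') s n).1 hn

include hcells hfib h0 in
/-- **Stages, surjectivity at the edge.** [cite: Spanier1981, Ch. 9, Sec. 2, Thm. 15; Sec. 3, Thm. 1 (proof)] -/
theorem epi_map_stage (hp : IsSerreFibration p) (hp' : IsSerreFibration p') (s : ℕ) {n : ℕ} (hn : n ≤ m + r) :
    Epi (cmap R f hf b₀ n s) :=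
  ((stage R f hf hcells hfib b₀ h0 hp hp') s n).2 hn

/-! ### Passage to `E = ⋃ₛ p⁻¹Xˢ` -/

omit [TopologicalSpace E] in
/-- The pieces over the skeleta increase. [folklore] -/
theorem monotone_tot (p : E → X) : Monotone (tot p) := fun _ _ h => preimage_mono (skel_mono h)

/-- **Every compact subset of `E` lies over a finite skeleton.** [cite: HatcherAT2002, Prop. A.1 (p. 520)] -/
theorem exists_subset_tot (hp : Continuous p) (K : Set E) (hK : IsCompact K) : ∃ s, K ⊆ tot p s := by
  obtain ⟨D, hD⟩ := exists_subset_skeletonLT_of_isCompact (hK.image hp)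
  refine ⟨D, fun e he => ?_⟩
  have h1 : p e ∈ (skeletonLT (univ : Set X) (D : ℕ∞) : Set X) := hD ⟨e, he, rfl⟩
  exact (skeletonLT_mono (by exact_mod_cast Nat.le_succ D) : (skeletonLT (univ : Set X) (D : ℕ∞) : Set X) ⊆ skel X D) h1

include hcells hfib h0 in
/-- **The Serre exact sequence over a CW base, comparison form — isomorphism range.** For a
Hausdorff CW complex with one `0`-cell `b₀` and no cells of dimension `1, …, m-1`, Serre
fibrations `p`, `p'` over it and a fibrewise map `f` inducing `H_k`-isomorphisms on all fibres for
`k < r` and surjections for `k = r`: `f_* : Hₙ(E, p⁻¹b₀) → Hₙ(E', p'⁻¹b₀)` is an isomorphism for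
`n < m + r`. [cite: Serre1951, Ch. III Prop. 5, Cor. 1; Spanier1981, Ch. 9, Sec. 3, Thm. 1 (proof)] -/
theorem isIso_map (hp : IsSerreFibration p) (hp' : IsSerreFibration p') {n : ℕ} (hn : n < m + r) :
    IsIso (relativeSingularHomology.map R R f (SerreCell.mapsTo_preimage f hf {b₀}) n) :=
  relativeSingularHomology.isIso_map_of_exhaustion R R f (SerreCell.mapsTo_preimage f hf {b₀}) (tot p) (tot p')
    (monotone_tot p) (monotone_tot p') (exists_subset_tot hp.continuous) (exists_subset_tot hp'.continuous)
    (mapsTo_tot f hf) n (fun s => isIso_map_stage R f hf hcells hfib b₀ h0 hp hp' s hn)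

include hcells hfib h0 in
/-- **The Serre exact sequence over a CW base, comparison form — surjectivity at the edge**
`n = m + r`. [cite: Serre1951, Ch. III Prop. 5, Cor. 1; Spanier1981, Ch. 9, Sec. 3, Thm. 1 (proof)] -/
theorem epi_map (hp : IsSerreFibration p) (hp' : IsSerreFibration p') {n : ℕ} (hn : n ≤ m + r) :
    Epi (relativeSingularHomology.map R R f (SerreCell.mapsTo_preimage f hf {b₀}) n) :=
  relativeSingularHomology.epi_map_of_exhaustion R R f (SerreCell.mapsTo_preimage f hf {b₀}) (tot p) (tot p')
    (exists_subset_tot hp'.continuous) (mapsTo_tot f hf) n (fun s => epi_map_stage R f hf hcells hfib b₀ h0 hp hp' s hn)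


/-! ### Bases whose low skeleton is only weakly contractible

The hypotheses `h0` (`X⁰ = {b₀}`) and `hcells` are used above only to start the induction at the
stage `0` and to discard cells of dimension `< m`. Mapping telescopes of CW complexes (Postnikov
sections, CW approximations built as telescopes) carry a contractible ray of `0`- and `1`-cells
instead of a single `0`-cell; for them we start the induction at a stage `s₀ ≥ m - 1` over whose
skeleton `Xˢ⁰` the fibre over `b₀` includes by a weak equivalence (`{b₀} ↪ Xˢ⁰` a weak
equivalence), the cells entering afterwards having dimension `> s₀ ≥ m - 1`. -/

include hfib in
/-- `cellMap_stable` for a cell of dimension `s + 1 ≥ m`, without the hypothesis on low cells.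
[cite: Spanier1981, Ch. 9, Sec. 2, Thm. 15 (a)] -/
theorem cellMap_stable_of_le (hp : IsSerreFibration p) (hp' : IsSerreFibration p') (n s : ℕ) (hms : m ≤ s + 1)
    (j : cell (univ : Set X) (s + 1)) :
    (n < m + r → IsIso (cellMap R f hf n j)) ∧ (n ≤ m + r → Epi (cellMap R f hf n j)) := by
  by_cases hns : n < s + 1
  · have h1 := SerreCell.isZero_of_lt R j hp hns
    have h2 := SerreCell.isZero_of_lt R j hp' hns
    haveI : IsIso (cellMap R f hf n j) := isIso_of_source_target_iso_zero _ h1.isoZero h2.isoZero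
    exact ⟨fun _ => inferInstance, fun _ => inferInstance⟩
  obtain ⟨k, rfl⟩ : ∃ k, n = k + (s + 1) := ⟨n - (s + 1), by omega⟩
  constructor
  · intro hn
    have hk : k < r := by omega
    exact (SerreCell.isIso_map_iff R j f hf hp hp' k).2 ((hfib _).1 k hk)
  · intro hn
    rcases (show k < r ∨ k = r by omega) with hk | rfl
    · haveI := (SerreCell.isIso_map_iff R j f hf hp hp' k).2 ((hfib _).1 k hk)
      infer_instance
    · exact (SerreCell.epi_map_iff R j f hf hp hp' k).2 (hfib _).2

omit [TopologicalSpace E] in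
/-- `p⁻¹b₀ ⊆ p⁻¹Xˢ` inside `p⁻¹Xˢ⁺¹` when `b₀ ∈ Xˢ`. [folklore] -/
theorem fib_subset_low_of_mem {s : ℕ} (hb : b₀ ∈ skel X s) :
    (Subtype.val ⁻¹' (p ⁻¹' {b₀}) : Set ↥(tot p (s + 1))) ⊆ low p (s + 1) := by
  intro z hz
  have hz' : p z.1 = b₀ := hz
  show p z.1 ∈ (skeletonLT (univ : Set X) ((s + 1 : ℕ) : ℕ∞) : Set X)
  rw [hz', Nat.cast_succ]
  exact hb

include hfib in
/-- **The induction step over one skeleton** (the body of `stage`): if the stage-`s` map is an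
isomorphism for `n < m + r` and onto for `n ≤ m + r`, so is the stage-`(s+1)` map, provided
`b₀ ∈ Xˢ` and `s + 1 ≥ m`. [cite: Spanier1981, Ch. 9, Sec. 2, Thm. 15 and Sec. 3, Thm. 1 (proof)] -/
theorem stage_step (hp : IsSerreFibration p) (hp' : IsSerreFibration p') (s : ℕ) (hms : m ≤ s + 1)
    (hb : b₀ ∈ skel X s)
    (ih : ∀ n, (n < m + r → IsIso (cmap R f hf b₀ n s)) ∧ (n ≤ m + r → Epi (cmap R f hf b₀ n s))) (n : ℕ) :
    (n < m + r → IsIso (cmap R f hf b₀ n (s + 1))) ∧ (n ≤ m + r → Epi (cmap R f hf b₀ n (s + 1))) := by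
    have hBA := fib_subset_low_of_mem (p := p) b₀ hb
    have hBA' := fib_subset_low_of_mem (p := p') b₀ hb
    -- (b) the map on `Hₖ(A₁, B₁)` is the stage-`s` map up to the homeomorphisms `lowHomeomorph`
    have hbb : ∀ k, (k < m + r → IsIso (relativeSingularHomology.map R R
        (subsetRestrict (stageMap f hf (s + 1)) (mapsTo_stageMap_low f hf (s + 1))) (mapsTo_restrict_low_fib f hf b₀ (s + 1)) k)) ∧
        (k ≤ m + r → Epi (relativeSingularHomology.map R R
        (subsetRestrict (stageMap f hf (s + 1)) (mapsTo_stageMap_low f hf (s + 1))) (mapsTo_restrict_low_fib f hf b₀ (s + 1)) k)) := by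
      intro k
      have he : MapsTo (lowHomeomorph p s) (Subtype.val ⁻¹' (Subtype.val ⁻¹' (p ⁻¹' {b₀}))) (Subtype.val ⁻¹' (p ⁻¹' {b₀})) :=
        fun z hz => hz
      have he_symm : MapsTo (lowHomeomorph p s).symm (Subtype.val ⁻¹' (p ⁻¹' {b₀})) (Subtype.val ⁻¹' (Subtype.val ⁻¹' (p ⁻¹' {b₀}))) :=
        fun z hz => hz
      have he' : MapsTo (lowHomeomorph p' s) (Subtype.val ⁻¹' (Subtype.val ⁻¹' (p' ⁻¹' {b₀}))) (Subtype.val ⁻¹' (p' ⁻¹' {b₀})) :=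
        fun z hz => hz
      have he'_symm : MapsTo (lowHomeomorph p' s).symm (Subtype.val ⁻¹' (p' ⁻¹' {b₀})) (Subtype.val ⁻¹' (Subtype.val ⁻¹' (p' ⁻¹' {b₀}))) :=
        fun z hz => hz
      haveI := relativeSingularHomology.isIso_map_homeomorph R R (lowHomeomorph p s) he he_symm k
      haveI := relativeSingularHomology.isIso_map_homeomorph R R (lowHomeomorph p' s) he' he'_symm k
      have hsq : relativeSingularHomology.map R R
          (subsetRestrict (stageMap f hf (s + 1)) (mapsTo_stageMap_low f hf (s + 1))) (mapsTo_restrict_low_fib f hf b₀ (s + 1)) k ≫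
          relativeSingularHomology.map R R (lowHomeomorph p' s : C(↥(low p' (s + 1)), ↥(tot p' s))) he' k =
          relativeSingularHomology.map R R (lowHomeomorph p s : C(↥(low p (s + 1)), ↥(tot p s))) he k ≫ cmap R f hf b₀ k s := by
        rw [cmap, ← relativeSingularHomology.map_comp, ← relativeSingularHomology.map_comp]
        exact relativeSingularHomology.map_congr R R (ContinuousMap.ext fun _ => rfl) _ _ k
      exact ⟨fun hk => (SerreCube.isIso_iff_of_square _ _ hsq).2 ((ih k).1 hk),
        fun hk => (SerreCube.epi_iff_of_square _ _ hsq).2 ((ih k).2 hk)⟩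
    -- (d) the map on `Hₖ(X₁, A₁)`
    have hd : ∀ k, (k < m + r → Mono (dmap R f hf k (s + 1))) ∧ (k ≤ m + r → Epi (dmap R f hf k (s + 1))) := by
      intro k
      refine ⟨fun hk => (mono_epi_dmap R f hf hp hp' k (s + 1)).1 fun j => ?_,
        fun hk => (mono_epi_dmap R f hf hp hp' k (s + 1)).2 fun j => ((cellMap_stable_of_le R f hf hfib hp hp' k s hms j).2 hk)⟩
      haveI := (cellMap_stable_of_le R f hf hfib hp hp' k s hms j).1 hk
      infer_instance
    -- the squares of the ladder
    have sq_i : ∀ k, relativeSingularHomology.map R R (⟨Subtype.val, continuous_subtype_val⟩ : C(↥(low p (s + 1)), ↥(tot p (s + 1))))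
        (mapsTo_val_preimage (low p (s + 1)) (Subtype.val ⁻¹' (p ⁻¹' {b₀}))) k ≫ cmap R f hf b₀ k (s + 1) =
        relativeSingularHomology.map R R
          (subsetRestrict (stageMap f hf (s + 1)) (mapsTo_stageMap_low f hf (s + 1))) (mapsTo_restrict_low_fib f hf b₀ (s + 1)) k ≫
        relativeSingularHomology.map R R (⟨Subtype.val, continuous_subtype_val⟩ : C(↥(low p' (s + 1)), ↥(tot p' (s + 1))))
          (mapsTo_val_preimage (low p' (s + 1)) (Subtype.val ⁻¹' (p' ⁻¹' {b₀}))) k := by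
      intro k
      rw [cmap, ← relativeSingularHomology.map_comp, ← relativeSingularHomology.map_comp]; rfl
    have sq_j : ∀ k, relativeSingularHomology.map R R (ContinuousMap.id ↥(tot p (s + 1))) (mapsTo_id_of_subset hBA) k ≫ dmap R f hf k (s + 1) =
        cmap R f hf b₀ k (s + 1) ≫ relativeSingularHomology.map R R (ContinuousMap.id ↥(tot p' (s + 1))) (mapsTo_id_of_subset hBA') k := by
      intro k
      rw [cmap, dmap, ← relativeSingularHomology.map_comp, ← relativeSingularHomology.map_comp]; rfl
    have sq_δ : ∀ k, dmap R f hf (k + 1) (s + 1) ≫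
          relativeSingularHomology.tripleδ R R ↥(tot p' (s + 1)) (low p' (s + 1)) (Subtype.val ⁻¹' (p' ⁻¹' {b₀})) k =
        relativeSingularHomology.tripleδ R R ↥(tot p (s + 1)) (low p (s + 1)) (Subtype.val ⁻¹' (p ⁻¹' {b₀})) k ≫
          relativeSingularHomology.map R R
            (subsetRestrict (stageMap f hf (s + 1)) (mapsTo_stageMap_low f hf (s + 1))) (mapsTo_restrict_low_fib f hf b₀ (s + 1)) k := by
      intro k
      rw [dmap, relativeSingularHomology.tripleδ, relativeSingularHomology.tripleδ, Category.assoc,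
        relativeSingularHomology.ofAbsolute_comp_map, ← Category.assoc,
        ← relativeSingularHomology.δ_naturality, Category.assoc]
    -- exactness of the two rows
    have ex₁ := fun k => relativeSingularHomology.triple_exact₁ R R hBA k
    have ex₂ := fun k => relativeSingularHomology.triple_exact₂ R R hBA k
    have ex₃ := fun k => relativeSingularHomology.triple_exact₃ R R hBA k
    have ex₁' := fun k => relativeSingularHomology.triple_exact₁ R R hBA' k
    have ex₂' := fun k => relativeSingularHomology.triple_exact₂ R R hBA' k
    have ex₃' := fun k => relativeSingularHomology.triple_exact₃ R R hBA' k
    refine ⟨fun hn => ?_, fun hn => ?_⟩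
    · -- isomorphism for `n < m + r`: mono by `mono_of_four`, epi by `epi_of_four` / `epi_of_three`
      haveI : Epi (dmap R f hf (n + 1) (s + 1)) := (hd (n + 1)).2 (by omega)
      haveI : Mono (relativeSingularHomology.map R R
        (subsetRestrict (stageMap f hf (s + 1)) (mapsTo_stageMap_low f hf (s + 1))) (mapsTo_restrict_low_fib f hf b₀ (s + 1)) n) := by
        haveI := (hbb n).1 hn; infer_instance
      haveI : Mono (dmap R f hf n (s + 1)) := (hd n).1 hn
      haveI hmono : Mono (cmap R f hf b₀ n (s + 1)) :=
        mono_of_four (dmap R f hf (n + 1) (s + 1)) _ (cmap R f hf b₀ n (s + 1)) (dmap R f hf n (s + 1))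
          (sq_δ n).symm (sq_i n) (sq_j n)
          (relativeSingularHomology.tripleδ_comp_map R R hBA n) (relativeSingularHomology.map_val_comp_map_id R R hBA n) (ex₂ n)
          (relativeSingularHomology.tripleδ_comp_map R R hBA' n) (ex₁' n)
      haveI hepi : Epi (cmap R f hf b₀ n (s + 1)) := by
        haveI : Epi (relativeSingularHomology.map R R
          (subsetRestrict (stageMap f hf (s + 1)) (mapsTo_stageMap_low f hf (s + 1))) (mapsTo_restrict_low_fib f hf b₀ (s + 1)) n) :=
          (hbb n).2 hn.le
        haveI : Epi (dmap R f hf n (s + 1)) := (hd n).2 hn.le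
        cases n with
        | zero =>
          haveI : Epi (relativeSingularHomology.map R R (ContinuousMap.id ↥(tot p (s + 1))) (mapsTo_id_of_subset hBA) 0) := by
            haveI := relativeSingularHomology.epi_ofAbsolute_zero R R (X := ↥(tot p (s + 1))) (low p (s + 1))
            have hfac : relativeSingularHomology.ofAbsolute R R ↥(tot p (s + 1)) (Subtype.val ⁻¹' (p ⁻¹' {b₀})) 0 ≫
                relativeSingularHomology.map R R (ContinuousMap.id ↥(tot p (s + 1))) (mapsTo_id_of_subset hBA) 0 =
                relativeSingularHomology.ofAbsolute R R ↥(tot p (s + 1)) (low p (s + 1)) 0 := by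
              rw [relativeSingularHomology.ofAbsolute_comp_map, singularHomology.map_id, Category.id_comp]
            exact epi_of_epi_fac hfac
          exact epi_of_three _ (cmap R f hf b₀ 0 (s + 1)) (dmap R f hf 0 (s + 1)) (sq_i 0) (sq_j 0)
            (relativeSingularHomology.map_val_comp_map_id R R hBA' 0) (ex₂' 0)
        | succ n =>
          haveI : Mono (relativeSingularHomology.map R R
            (subsetRestrict (stageMap f hf (s + 1)) (mapsTo_stageMap_low f hf (s + 1))) (mapsTo_restrict_low_fib f hf b₀ (s + 1)) n) := by
            haveI := (hbb n).1 (by omega); infer_instance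
          exact epi_of_four _ (cmap R f hf b₀ (n + 1) (s + 1)) (dmap R f hf (n + 1) (s + 1)) _
            (sq_i (n + 1)) (sq_j (n + 1)) (sq_δ n).symm
            (relativeSingularHomology.map_comp_tripleδ R R hBA n) (ex₃ n)
            (relativeSingularHomology.map_val_comp_map_id R R hBA' (n + 1)) (ex₂' (n + 1))
            (relativeSingularHomology.map_comp_tripleδ R R hBA' n)
      exact isIso_of_mono_of_epi _
    · -- surjectivity for `n ≤ m + r`
      haveI : Epi (relativeSingularHomology.map R R
        (subsetRestrict (stageMap f hf (s + 1)) (mapsTo_stageMap_low f hf (s + 1))) (mapsTo_restrict_low_fib f hf b₀ (s + 1)) n) :=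
        (hbb n).2 hn
      haveI : Epi (dmap R f hf n (s + 1)) := (hd n).2 hn
      cases n with
      | zero =>
        haveI : Epi (relativeSingularHomology.map R R (ContinuousMap.id ↥(tot p (s + 1))) (mapsTo_id_of_subset hBA) 0) := by
          haveI := relativeSingularHomology.epi_ofAbsolute_zero R R (X := ↥(tot p (s + 1))) (low p (s + 1))
          have hfac : relativeSingularHomology.ofAbsolute R R ↥(tot p (s + 1)) (Subtype.val ⁻¹' (p ⁻¹' {b₀})) 0 ≫
              relativeSingularHomology.map R R (ContinuousMap.id ↥(tot p (s + 1))) (mapsTo_id_of_subset hBA) 0 =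
              relativeSingularHomology.ofAbsolute R R ↥(tot p (s + 1)) (low p (s + 1)) 0 := by
            rw [relativeSingularHomology.ofAbsolute_comp_map, singularHomology.map_id, Category.id_comp]
          exact epi_of_epi_fac hfac
        exact epi_of_three _ (cmap R f hf b₀ 0 (s + 1)) (dmap R f hf 0 (s + 1)) (sq_i 0) (sq_j 0)
          (relativeSingularHomology.map_val_comp_map_id R R hBA' 0) (ex₂' 0)
      | succ n =>
        haveI : Mono (relativeSingularHomology.map R R
          (subsetRestrict (stageMap f hf (s + 1)) (mapsTo_stageMap_low f hf (s + 1))) (mapsTo_restrict_low_fib f hf b₀ (s + 1)) n) := by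
          haveI := (hbb n).1 (by omega); infer_instance
        exact epi_of_four _ (cmap R f hf b₀ (n + 1) (s + 1)) (dmap R f hf (n + 1) (s + 1)) _
          (sq_i (n + 1)) (sq_j (n + 1)) (sq_δ n).symm
          (relativeSingularHomology.map_comp_tripleδ R R hBA n) (ex₃ n)
          (relativeSingularHomology.map_val_comp_map_id R R hBA' (n + 1)) (ex₂' (n + 1))
          (relativeSingularHomology.map_comp_tripleδ R R hBA' n)


include hfib in
/-- **The induction over the skeleta from a weakly contractible stage**: if `b₀ ∈ Xˢ⁰`,
`{b₀} ↪ Xˢ⁰` is a weak homotopy equivalence and `s₀ + 1 ≥ m`, then for all `t`,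
`f_* : Hₙ(p⁻¹Xˢ⁰⁺ᵗ, p⁻¹b₀) → Hₙ(p'⁻¹Xˢ⁰⁺ᵗ, p'⁻¹b₀)` is an isomorphism for `n < m + r` and onto
for `n ≤ m + r`. [cite: Serre1951, Ch. III Prop. 5, Cor. 1; Spanier1981, Ch. 9, Sec. 3, Thm. 1 (proof)] -/
theorem stage_from (hp : IsSerreFibration p) (hp' : IsSerreFibration p') (s₀ : ℕ) (hms : m ≤ s₀ + 1)
    (hb : b₀ ∈ skel X s₀) (hw : IsWeakHomotopyEquiv (subsetInclusion (singleton_subset_iff.2 hb))) :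
    ∀ (t n : ℕ), (n < m + r → IsIso (cmap R f hf b₀ n (s₀ + t))) ∧ (n ≤ m + r → Epi (cmap R f hf b₀ n (s₀ + t))) := by
  intro t
  induction t with
  | zero =>
    intro n
    have hz : IsZero (relativeSingularHomology R R ↥(tot p s₀) (Subtype.val ⁻¹' (p ⁻¹' {b₀})) n) :=
      hp.isZero_relativeSingularHomology_preimage (singleton_subset_iff.2 hb) hw R n
    have hz' : IsZero (relativeSingularHomology R R ↥(tot p' s₀) (Subtype.val ⁻¹' (p' ⁻¹' {b₀})) n) :=
      hp'.isZero_relativeSingularHomology_preimage (singleton_subset_iff.2 hb) hw R n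
    haveI : IsIso (cmap R f hf b₀ n (s₀ + 0)) := isIso_of_source_target_iso_zero _ hz.isoZero hz'.isoZero
    exact ⟨fun _ => inferInstance, fun _ => inferInstance⟩
  | succ t ih =>
    exact stage_step R f hf hfib b₀ hp hp' (s₀ + t) (by omega) (skel_mono (Nat.le_add_right s₀ t) hb) ih

include hfib in
/-- **The Serre exact sequence over a CW base whose low skeleton is weakly contractible —
isomorphism range**: `f_* : Hₙ(E, p⁻¹b₀) → Hₙ(E', p'⁻¹b₀)` is an isomorphism for `n < m + r`
when `b₀ ∈ Xˢ⁰`, `{b₀} ↪ Xˢ⁰` is a weak homotopy equivalence, `s₀ + 1 ≥ m`, and the fibre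
condition holds. [cite: Serre1951, Ch. III Prop. 5, Cor. 1; Spanier1981, Ch. 9, Sec. 3, Thm. 1 (proof)] -/
theorem isIso_map_of_isWeakHomotopyEquiv (hp : IsSerreFibration p) (hp' : IsSerreFibration p') (s₀ : ℕ)
    (hms : m ≤ s₀ + 1) (hb : b₀ ∈ skel X s₀) (hw : IsWeakHomotopyEquiv (subsetInclusion (singleton_subset_iff.2 hb)))
    {n : ℕ} (hn : n < m + r) :
    IsIso (relativeSingularHomology.map R R f (SerreCell.mapsTo_preimage f hf {b₀}) n) :=
  relativeSingularHomology.isIso_map_of_exhaustion R R f (SerreCell.mapsTo_preimage f hf {b₀})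
    (fun t => tot p (s₀ + t)) (fun t => tot p' (s₀ + t))
    (fun _ _ h => monotone_tot p (Nat.add_le_add_left h s₀)) (fun _ _ h => monotone_tot p' (Nat.add_le_add_left h s₀))
    (fun K hK => by obtain ⟨s, hs⟩ := exists_subset_tot hp.continuous K hK; exact ⟨s, hs.trans (monotone_tot p (Nat.le_add_left s s₀))⟩)
    (fun K hK => by obtain ⟨s, hs⟩ := exists_subset_tot hp'.continuous K hK; exact ⟨s, hs.trans (monotone_tot p' (Nat.le_add_left s s₀))⟩)
    (fun t => mapsTo_tot f hf (s₀ + t)) n (fun t => (stage_from R f hf hfib b₀ hp hp' s₀ hms hb hw t n).1 hn)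

include hfib in
/-- **… and surjectivity at the edge** `n ≤ m + r`. [cite: Serre1951, Ch. III Prop. 5, Cor. 1] -/
theorem epi_map_of_isWeakHomotopyEquiv (hp : IsSerreFibration p) (hp' : IsSerreFibration p') (s₀ : ℕ)
    (hms : m ≤ s₀ + 1) (hb : b₀ ∈ skel X s₀) (hw : IsWeakHomotopyEquiv (subsetInclusion (singleton_subset_iff.2 hb)))
    {n : ℕ} (hn : n ≤ m + r) :
    Epi (relativeSingularHomology.map R R f (SerreCell.mapsTo_preimage f hf {b₀}) n) :=
  relativeSingularHomology.epi_map_of_exhaustion R R f (SerreCell.mapsTo_preimage f hf {b₀})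
    (fun t => tot p (s₀ + t)) (fun t => tot p' (s₀ + t))
    (fun K hK => by obtain ⟨s, hs⟩ := exists_subset_tot hp'.continuous K hK; exact ⟨s, hs.trans (monotone_tot p' (Nat.le_add_left s s₀))⟩)
    (fun t => mapsTo_tot f hf (s₀ + t)) n (fun t => (stage_from R f hf hfib b₀ hp hp' s₀ hms hb hw t n).2 hn)

end Stage

end SerreSkeleta

end Literature.AlgebraicTopology.Homotopy

end
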